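import Literature.Probability.RandomPlanarGeometry.HullSubdomainPullback
import Literature.Probability.RandomPlanarGeometry.StarHullCanonical
import Literature.Probability.RandomPlanarGeometry.CaratheodoryHalfPlaneProofs
import Literature.Probability.RandomPlanarGeometry.ConformalMapCaratheodoryProofs
import Literature.Probability.RandomPlanarGeometry.JordanDomainProofs
import Literature.Probability.RandomPlanarGeometry.ConformalMapRiemannProofs
import Literature.Probability.RandomPlanarGeometry.ChordalCurveFamilyProofs
import HarnessLib

/-!
# The chordal map `φ ∘ Φ_A⁻¹` of a hull subdomain: boundary values through `E_A`

Topic `Probability/RandomPlanarGeometry`; theorems only. Deterministic lemmas for the reduction of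
the bounded clause of the locality of chordal SLE₆ (`IsSLELaw.locality_six_bounded`,
`SLESixHullLocalityFact.lean`) to its half-plane form (`sle_six_hull_locality`), file
`SLESixHullLocalityReduction.lean`. For a chordal uniformizing map `ψ` of a Dobrushin domain
`(D; a, b)`, a hull subdomain `D'` (`D.IsHullSubdomain D'`), the pulled-back `*`-hull
`A = ψ.pullbackHull D'` with canonical map `Φ_A = starRMap A` and reflected extension
`E_A = starMap A`, and the chordal map `ψ' = ψ ∘ Φ_A⁻¹` of `D'`
(`MarkedDomain.IsChordalUniformizing.pullback`):

* `ConformalEquiv.pullbackChordal` — the map `ψ' = Φ_A⁻¹ ≫ ψ|` as a `ConformalEquiv ℍ D'`;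
* `continuousAt_starMap`, `continuousOn_starMap`, `starMap_im_nonneg`, `starMap_mem_of_mem_diff`
  — `E_A` is continuous at every point of the closed half-plane off `A` and maps it into the
  closed half-plane (`ℍ ∖ A` into `ℍ`);
* **`ConformalEquiv.boundaryExtension_pullbackChordal_starMap`** — `Ψ'(E_A z) = Ψ(z)` for
  `z` in the closed half-plane off `A`, `Ψ, Ψ'` the boundary extensions of `ψ, ψ'` (interior: by
  definition; real points: both are limits of `ψ` along `ℍ ∖ A`, Carathéodory boundary values of
  `ψ` and `ψ'` exist, `JordanDomain.exists_hasBoundaryValue_holds`);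
* `ConformalEquiv.boundaryExtension_mem_closure_diff_of_mem_pullbackHull` — `Ψ(A) ⊆ closure (D ∖ D')`;
* `ConformalEquiv.pullbackHull_nonempty` — `A ≠ ∅` when `D' ≠ D`;
* `Curve.hitSet_union_eq_of`, `Curve.stopAt_union_eq_of` — stopping at `F ∪ G` is stopping at
  `F` when `G` is met only at the final parameter (used with `G = {b}`).

References: Lawler–Schramm–Werner (2003), §2 p. 9 and §5; Pommerenke (1992), Thm. 2.1.
-/

noncomputable section

open Set Filter Topology Complex Metric
open UpperHalfPlane (upperHalfPlaneSet isOpen_upperHalfPlaneSet)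
open scoped NNReal unitInterval ComplexConjugate

namespace Literature.Probability.RandomPlanarGeometry

/-! ### Stopping at `F ∪ G` when `G` is met only at the end -/

namespace Curve

variable {E : Type*} [MetricSpace E]

/-- If `G` is met only at parameter `1`, the hit sets of `F ∪ G` and `F` agree. [folklore] -/
theorem hitSet_union_eq_of {F G : Set E} {γ : Curve E} (h : ∀ t : I, γ t ∈ G → (t : ℝ) = 1) :
    γ.hitSet (F ∪ G) = γ.hitSet F := by
  ext t
  simp only [hitSet, mem_union, mem_setOf_eq, mem_singleton_iff]
  constructor
  · rintro (⟨ht, hF | hG⟩ | rfl)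
    · exact Or.inl ⟨ht, hF⟩
    · exact Or.inr (h ⟨t, ht⟩ hG)
    · exact Or.inr rfl
  · rintro (⟨ht, hF⟩ | rfl)
    · exact Or.inl ⟨ht, Or.inl hF⟩
    · exact Or.inr rfl

/-- If `G` is met only at parameter `1`, the hitting parameters of `F ∪ G` and `F` agree.
[folklore] -/
theorem hitParam_union_eq_of {F G : Set E} {γ : Curve E} (h : ∀ t : I, γ t ∈ G → (t : ℝ) = 1) :
    γ.hitParam (F ∪ G) = γ.hitParam F := by
  unfold hitParam
  rw [hitSet_union_eq_of h]

/-- **Stopping at `F ∪ G` is stopping at `F` when `G` is met only at the final parameter.**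
[folklore] -/
theorem stopAt_union_eq_of {F G : Set E} {γ : Curve E} (h : ∀ t : I, γ t ∈ G → (t : ℝ) = 1) :
    γ.stopAt (F ∪ G) = γ.stopAt F := by
  unfold stopAt
  rw [hitParam_union_eq_of h]

end Curve

/-! ### The reflected canonical map `E_A` on the closed half-plane off `A` -/

section StarMap

variable {A : Set ℂ}

/-- A point of the closed half-plane off the hull is in the symmetric domain of `A`. [folklore] -/
theorem mem_symmDomain_of_im_nonneg (hA : IsStarHull A) {z : ℂ} (hz : 0 ≤ z.im) (hzA : z ∉ A) :
    z ∈ symmDomain A := by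
  refine ⟨hzA, fun hc ↦ ?_⟩
  have hcl : closure upperHalfPlaneSet = {w : ℂ | 0 ≤ w.im} := Complex.closure_setOf_lt_im 0
  have hAsub : A ⊆ {w : ℂ | 0 ≤ w.im} := by
    rw [← hA.1.2.1, ← hcl]
    exact closure_mono inter_subset_right
  have him : 0 ≤ (conj z).im := hAsub hc
  rw [Complex.conj_im] at him
  have h0 : z.im = 0 := le_antisymm (by linarith) hz
  have : conj z = z := Complex.conj_eq_iff_im.2 h0
  exact hzA (this ▸ hc)

/-- `E_A` is continuous at every point of the closed half-plane off `A`. [folklore] -/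
theorem continuousAt_starMap (hA : IsStarHull A) {z : ℂ} (hz : 0 ≤ z.im) (hzA : z ∉ A) :
    ContinuousAt (starMap A) z := by
  rw [starMap_eq hA]
  exact (differentiableAt_hullExt hA.1 (isRestrictionMap_starRMap hA)
    (mem_symmDomain_of_im_nonneg hA hz hzA)).continuousAt

/-- `E_A` is continuous on the closed half-plane off `A`. [folklore] -/
theorem continuousOn_starMap (hA : IsStarHull A) :
    ContinuousOn (starMap A) {z : ℂ | 0 ≤ z.im ∧ z ∉ A} := fun _ hz ↦
  (continuousAt_starMap hA hz.1 hz.2).continuousWithinAt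

/-- On `ℍ ∖ A`, `E_A = Φ_A` takes values in `ℍ`. [folklore] -/
theorem starMap_mem_of_mem_diff (hA : IsStarHull A) {z : ℂ} (hz : z ∈ upperHalfPlaneSet \ A) :
    starMap A z ∈ upperHalfPlaneSet := by
  rw [starMap_eq hA, hullExt_of_mem_diff hz]
  exact (starRMap A hA).mapsTo hz

/-- On `ℍ ∖ A`, `E_A z = Φ_A z`. [folklore] -/
theorem starMap_of_mem_diff (hA : IsStarHull A) {z : ℂ} (hz : z ∈ upperHalfPlaneSet \ A) :
    starMap A z = starRMap A hA z := by
  rw [starMap_eq hA, hullExt_of_mem_diff hz]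

/-- `E_A` maps the closed half-plane off `A` into the closed half-plane. [folklore] -/
theorem starMap_im_nonneg (hA : IsStarHull A) {z : ℂ} (hz : 0 ≤ z.im) (hzA : z ∉ A) :
    0 ≤ (starMap A z).im := by
  rcases hz.lt_or_eq with hpos | h0
  · exact le_of_lt (starMap_mem_of_mem_diff hA ⟨hpos, hzA⟩)
  · have hzre : z = ((z.re : ℝ) : ℂ) := Complex.ext (by simp) (by simp [← h0])
    rw [hzre] at hzA ⊢
    rw [starMap_eq hA, hullExt_ofReal_im hA.1 (isRestrictionMap_starRMap hA) hzA]

/-- A point of the closed half-plane off the (closed) hull is in the closure of `ℍ ∖ A`; indeed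
`𝓝[ℍ ∖ A] z` is nontrivial. [folklore] -/
theorem nhdsWithin_diff_neBot (hA : IsStarHull A) {z : ℂ} (hz : 0 ≤ z.im) (hzA : z ∉ A) :
    (𝓝[upperHalfPlaneSet \ A] z).NeBot := by
  rw [← mem_closure_iff_nhdsWithin_neBot, Metric.mem_closure_iff]
  intro ε hε
  -- a small ball around `z` misses `A`; move up by `δ`
  have hAc : IsClosed A := hA.1.isClosed
  obtain ⟨δ, hδ, hball⟩ := Metric.isOpen_iff.1 hAc.isOpen_compl z hzA
  refine ⟨z + ((min (δ / 2) (ε / 2) : ℝ) : ℂ) * Complex.I, ⟨?_, ?_⟩, ?_⟩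
  · show 0 < (z + ((min (δ / 2) (ε / 2) : ℝ) : ℂ) * Complex.I).im
    simp only [Complex.add_im, Complex.mul_im, Complex.ofReal_re, Complex.I_im, mul_one,
      Complex.ofReal_im, Complex.I_re, mul_zero, add_zero]
    have : 0 < min (δ / 2) (ε / 2) := lt_min (by linarith) (by linarith)
    linarith
  · apply hball
    rw [Metric.mem_ball, dist_eq_norm]
    simp only [add_sub_cancel_left, Complex.norm_mul, Complex.norm_real, Complex.norm_I, mul_one,
      Real.norm_eq_abs]
    rw [abs_of_pos (lt_min (by linarith) (by linarith))]
    exact (min_le_left _ _).trans_lt (by linarith)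
  · rw [dist_comm, dist_eq_norm]
    simp only [add_sub_cancel_left, Complex.norm_mul, Complex.norm_real, Complex.norm_I, mul_one,
      Real.norm_eq_abs]
    rw [abs_of_pos (lt_min (by linarith) (by linarith))]
    exact (min_le_right _ _).trans_lt (by linarith)

/-- `E_A → E_A z` within `ℍ` along `ℍ ∖ A`, at a point of the closed half-plane off `A`.
[folklore] -/
theorem tendsto_starMap_nhdsWithin_diff (hA : IsStarHull A) {z : ℂ} (hz : 0 ≤ z.im) (hzA : z ∉ A) :
    Tendsto (starMap A) (𝓝[upperHalfPlaneSet \ A] z) (𝓝[upperHalfPlaneSet] (starMap A z)) :=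
  tendsto_nhdsWithin_iff.2 ⟨(continuousAt_starMap hA hz hzA).tendsto.mono_left nhdsWithin_le_nhds,
    eventually_nhdsWithin_of_forall fun _ hw ↦ starMap_mem_of_mem_diff hA hw⟩

end StarMap

/-! ### The chordal map `ψ ∘ Φ_A⁻¹` of the hull subdomain and its boundary values -/

namespace ConformalEquiv

variable {D D' : DobrushinDomain} (ψ : ConformalEquiv upperHalfPlaneSet D.carrier)

/-- **The chordal map `ψ' = ψ ∘ Φ_A⁻¹ : ℍ → D'`** of a subdomain `D' ⊆ D`, through the canonical
map `Φ_A = starRMap A` of the pulled-back `*`-hull `A = ψ.pullbackHull D'`.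
[cite: LawlerSchrammWerner2003Restriction, §2 p. 9] -/
def pullbackChordal (hsub : D'.carrier ⊆ D.carrier) (hA : IsStarHull (ψ.pullbackHull D')) :
    ConformalEquiv upperHalfPlaneSet D'.carrier :=
  (starRMap (ψ.pullbackHull D') hA).symm.trans (ψ.restrHull D' hsub)

variable {ψ}

/-- `ψ' (Φ_A z) = ψ z` on `ℍ ∖ A`. [folklore] -/
theorem pullbackChordal_apply_starRMap (hsub : D'.carrier ⊆ D.carrier)
    (hA : IsStarHull (ψ.pullbackHull D')) {z : ℂ} (hz : z ∈ upperHalfPlaneSet \ ψ.pullbackHull D') :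
    ψ.pullbackChordal hsub hA (starRMap (ψ.pullbackHull D') hA z) = ψ z := by
  rw [pullbackChordal, ConformalEquiv.trans_apply, ConformalEquiv.symm_apply_apply _ hz,
    restrHull_apply]

/-- `ψ' (E_A z) = ψ z` on `ℍ ∖ A`. [folklore] -/
theorem pullbackChordal_apply_starMap (hsub : D'.carrier ⊆ D.carrier)
    (hA : IsStarHull (ψ.pullbackHull D')) {z : ℂ} (hz : z ∈ upperHalfPlaneSet \ ψ.pullbackHull D') :
    ψ.pullbackChordal hsub hA (starMap (ψ.pullbackHull D') z) = ψ z := by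
  rw [starMap_of_mem_diff hA hz, pullbackChordal_apply_starRMap hsub hA hz]

/-- **`ψ'` is a chordal uniformizing map of `(D'; a, b)`** for a hull subdomain.
[cite: LawlerSchrammWerner2003Restriction, §2 p. 9] -/
theorem isChordalUniformizing_pullbackChordal (hψ : D.IsChordalUniformizing ψ)
    (hD' : D.IsHullSubdomain D') (hA : IsStarHull (ψ.pullbackHull D')) :
    D'.IsChordalUniformizing (ψ.pullbackChordal hD'.carrier_subset hA) :=
  MarkedDomain.IsChordalUniformizing.pullback JordanDomain.isSimplyConnected_holds
    exists_conformalEquiv_ball_holds JordanDomain.exists_continuousOn_extension_holds hψ hD'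
    (isRestrictionMap_starRMap hA)

/-- **Boundary values through `E_A`**: `Ψ'(E_A z) = Ψ(z)` for `z` in the closed half-plane off
`A`, where `Ψ = ψ.boundaryExtension`, `Ψ' = ψ'.boundaryExtension`. [folklore] -/
theorem boundaryExtension_pullbackChordal_starMap (hsub : D'.carrier ⊆ D.carrier)
    (hA : IsStarHull (ψ.pullbackHull D')) {z : ℂ} (hz : 0 ≤ z.im) (hzA : z ∉ ψ.pullbackHull D') :
    (ψ.pullbackChordal hsub hA).boundaryExtension (starMap (ψ.pullbackHull D') z) =
      ψ.boundaryExtension z := by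
  set A := ψ.pullbackHull D' with hAdef
  set ψ' := ψ.pullbackChordal hsub hA with hψ'def
  set w := starMap A z with hw
  have hcl : closure upperHalfPlaneSet = {w : ℂ | 0 ≤ w.im} := Complex.closure_setOf_lt_im 0
  have hwim : 0 ≤ w.im := starMap_im_nonneg hA hz hzA
  -- boundary values of `ψ` at `z` and of `ψ'` at `w` exist (Carathéodory)
  obtain ⟨p, hp⟩ : ∃ p, ψ.HasBoundaryValue z p := by
    rcases hz.lt_or_eq with hpos | h0
    · exact ⟨ψ z, ψ.hasBoundaryValue_apply hpos⟩
    · have hzre : z = ((z.re : ℝ) : ℂ) := Complex.ext (by simp) (by simp [← h0])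
      obtain ⟨p, -, hp⟩ := JordanDomain.exists_hasBoundaryValue_holds D.toJordanDomain ψ z.re
      exact ⟨p, hzre ▸ hp⟩
  obtain ⟨q, hq⟩ : ∃ q, ψ'.HasBoundaryValue w q := by
    rcases hwim.lt_or_eq with hpos | h0
    · exact ⟨ψ' w, ψ'.hasBoundaryValue_apply hpos⟩
    · have hwre : w = ((w.re : ℝ) : ℂ) := Complex.ext (by simp) (by simp [← h0])
      obtain ⟨q, -, hq⟩ := JordanDomain.exists_hasBoundaryValue_holds D'.toJordanDomain ψ' w.re
      exact ⟨q, hwre ▸ hq⟩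
  rw [ψ'.boundaryExtension_eq_of_hasBoundaryValue (by rw [hcl]; exact hwim) hq,
    ψ.boundaryExtension_eq_of_hasBoundaryValue (by rw [hcl]; exact hz) hp]
  -- both are limits of `ψ` along `ℍ ∖ A`
  haveI := nhdsWithin_diff_neBot hA hz hzA
  have h1 : Tendsto ψ (𝓝[upperHalfPlaneSet \ A] z) (𝓝 p) :=
    hp.mono_left (nhdsWithin_mono _ sdiff_subset)
  have h2 : Tendsto (fun u ↦ ψ' (starMap A u)) (𝓝[upperHalfPlaneSet \ A] z) (𝓝 q) :=
    hq.comp (tendsto_starMap_nhdsWithin_diff hA hz hzA)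
  have h3 : Tendsto ψ (𝓝[upperHalfPlaneSet \ A] z) (𝓝 q) :=
    h2.congr' (eventually_nhdsWithin_of_forall fun u hu ↦ pullbackChordal_apply_starMap hsub hA hu)
  exact (tendsto_nhds_unique h3 h1).symm ▸ rfl

/-- **`Ψ(A) ⊆ closure (D ∖ D')`**: the boundary extension sends the pulled-back hull into the
closed removed part (`A = closure (A ∩ ℍ)` and `ψ(A ∩ ℍ) ⊆ D ∖ D'`). [folklore] -/
theorem boundaryExtension_mem_closure_diff_of_mem_pullbackHull
    (hcont : ContinuousOn ψ.boundaryExtension (closure upperHalfPlaneSet)) {z : ℂ}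
    (hz : z ∈ ψ.pullbackHull D') :
    ψ.boundaryExtension z ∈ closure (D.carrier \ D'.carrier) := by
  have hcl : closure upperHalfPlaneSet = {w : ℂ | 0 ≤ w.im} := Complex.closure_setOf_lt_im 0
  have hz' : z ∈ closure (ψ.pullbackHull D' ∩ upperHalfPlaneSet) := by
    rw [ConformalEquiv.closure_pullbackHull_inter]; exact hz
  -- on `A ∩ ℍ` the extension is `ψ`, with values in `D ∖ D'`
  have hmaps : MapsTo ψ.boundaryExtension (ψ.pullbackHull D' ∩ upperHalfPlaneSet)
      (D.carrier \ D'.carrier) := by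
    intro u hu
    have huH : u ∈ upperHalfPlaneSet := hu.2
    rw [ψ.boundaryExtension_eq huH]
    refine ⟨ψ.mapsTo huH, fun huD' ↦ ?_⟩
    have : u ∈ upperHalfPlaneSet \ ψ.pullbackHull D' := by
      rw [ConformalEquiv.diff_pullbackHull]; exact ⟨huH, huD'⟩
    exact this.2 hu.1
  have hsub : ψ.pullbackHull D' ∩ upperHalfPlaneSet ⊆ closure upperHalfPlaneSet :=
    fun u hu ↦ subset_closure hu.2
  have hzcl : z ∈ closure upperHalfPlaneSet := closure_mono (fun u hu ↦ hu.2) hz'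
  have h1 : ψ.boundaryExtension z ∈
      closure (ψ.boundaryExtension '' (ψ.pullbackHull D' ∩ upperHalfPlaneSet)) :=
    ((hcont.continuousWithinAt hzcl).mono hsub).mem_closure_image hz'
  exact closure_mono (hmaps.image_subset) h1

/-- **The pulled-back hull of a proper subdomain is nonempty.** [folklore] -/
theorem pullbackHull_nonempty (hsub : D'.carrier ⊆ D.carrier) (hne : D'.carrier ≠ D.carrier) :
    (ψ.pullbackHull D').Nonempty := by
  obtain ⟨w, hwD, hwD'⟩ : ∃ w ∈ D.carrier, w ∉ D'.carrier := by
    by_contra h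
    push Not at h
    exact hne (Subset.antisymm hsub h)
  refine ⟨ψ.symm w, subset_closure ⟨ψ.symm.mapsTo hwD, fun hmem ↦ hwD' ?_⟩⟩
  have : ψ (ψ.symm w) ∈ D'.carrier := hmem.2
  rwa [ψ.apply_symm_apply hwD] at this

end ConformalEquiv

end Literature.Probability.RandomPlanarGeometry

end
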